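import Summits.MatrixMultiplication.MatrixMultiplication.Theorems.SoloInformedOrbitRank
import HarnessLib

/-!
# Orbit-map rank certificates: `cw₂ ⋭ N₅` in characteristic `2`

Solo programme `solo-MatrixMultiplication-informed`, generation 27; continuation of
`SoloInformedOrbitRank` (the orbit form `O_T` and its semicontinuity under degeneration).

* `ocode` — `O_N` for integer `N` on the codes `9a+3b+c` / `9f+3p+q`, kernel-evaluable;
  `le_rank_orbitForm_of_cert` (unit-pivot integer row certificates give `rank ≥ n` over EVERY field),
  `okerCheck` / `rank_orbitForm_add_le_of_okerCheck` (kernel vectors modulo `d` give `rank ≤ 27 - k`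
  over fields with `d = 0`).
* **Certificates** (`decide +kernel`): `rank O_{N₅} ≥ 21` over every field and `rank O_{cw₂} ≤ 20`
  in characteristic `2` (seven kernel vectors modulo `2`; over `ℂ` the rank is `23`).  Hence
  **`cw₂ ⋭ N₅` over every field of characteristic `2`**
  (`not_cwTensor_two_polyDegeneratesTo_nurmiev_five_of_two`), although `cw₂ ⊵ N₅` over `ℂ`
  (`cwTensor_two_polyDegeneratesTo_nurmiev_iff`): the first kernel-certified row of the door tensor's
  census whose ANSWER changes with the characteristic (rows `8`, `9` fail in characteristic `2` too,
  on paper: Theorem H and the repeated line of the pencil cubic; the Cayley form `Ω` cannot see row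
  `5`, its rank modulo `2` being `22` for both tensors).
Sources: [cite: Nurmiev2000, Table 2]; [cite: Alman2021, §2.4];
[cite: ConnerGesmundoLandsbergVentura2022, §3.2].  Everything here is PROVED; no new axioms.
-/

namespace Summit.MatrixMultiplication.MatrixMultiplication.Theorems

open Matrix Polynomial Finset
open Literature.Computability.AlgebraicComplexity Literature.Barriers.MatrixMultiplication
open Literature.LinearAlgebra.Matrix
open scoped Kronecker Polynomial

universe u

namespace OrbitRank

open CayleyOmega

/-! ## Kernel-evaluable presentation and certificates -/

section Cert

/-- Integer code matrix of `O_N` on codes `9a+3b+c` (rows) and `9f+3p+q` (columns). [folklore] -/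
def ocode (N : Fin 3 → Fin 3 → Fin 3 → ℤ) (r c : ℕ) : ℤ :=
  if (dec c).1 = 0 then
    (if (dec r).1 = (dec c).2.1 then N (dec c).2.2 (dec r).2.1 (dec r).2.2 else 0)
  else if (dec c).1 = 1 then
    (if (dec r).2.1 = (dec c).2.1 then N (dec r).1 (dec c).2.2 (dec r).2.2 else 0)
  else (if (dec r).2.2 = (dec c).2.1 then N (dec r).1 (dec r).2.1 (dec c).2.2 else 0)

/-- The code matrix IS `O_N` read through the decoder. [folklore] -/
theorem ocode_eq (N : Fin 3 → Fin 3 → Fin 3 → ℤ) (r c : ℕ) :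
    ocode N r c = orbitForm N (dec r) (dec c) := by
  rw [orbitForm_apply, ocode]

/-- **Rank lower bounds in every characteristic** from a unit-pivot certificate. [folklore] -/
theorem le_rank_orbitForm_of_cert {F : Type*} [Field F] (N : Fin 3 → Fin 3 → Fin 3 → ℤ) {n : ℕ}
    {rows : List (List (ℕ × ℤ))} {piv : List ℕ} (h : intTriCheckUnit n (ocode N) rows piv = true) :
    n ≤ (orbitForm (fun a b c => (N a b c : F))).rank := by
  have e : ocode N = fun r c => orbitForm N (dec r) (dec c) :=
    funext fun r => funext fun c => ocode_eq N r c
  rw [e] at h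
  have := le_rank_of_intTriCheckUnit (F := F) (orbitForm N) dec dec h
  rwa [orbitForm_map_intCast] at this

/-- The kernel test: every listed sparse vector (on column codes) is killed by `O_N` modulo `d`.
[folklore] -/
def okerCheck (d : ℤ) (N : Fin 3 → Fin 3 → Fin 3 → ℤ) (k : ℕ) (Ls : List (List (ℕ × ℤ))) : Bool :=
  (List.range 27).all fun r => (List.range k).all fun i =>
    ((Ls.getD i []).map fun qc : ℕ × ℤ => qc.2 * ocode N r qc.1).sum % d == 0

/-- Soundness of the kernel test: `d ∣ (O_N · W)_{p i}`. [folklore] -/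
theorem dvd_of_okerCheck {d : ℤ} {N : Fin 3 → Fin 3 → Fin 3 → ℤ} {k : ℕ} {Ls : List (List (ℕ × ℤ))}
    (h : okerCheck d N k Ls = true) (p : Idx) (i : Fin k) :
    d ∣ (orbitForm N * spMat Ls k) p i := by
  rw [← dec_enc p]
  unfold okerCheck at h
  rw [List.all_eq_true] at h
  have h1 := h (enc p) (List.mem_range.2 (enc_lt p))
  rw [List.all_eq_true] at h1
  have h2 := h1 i (List.mem_range.2 i.isLt)
  simp only [beq_iff_eq, ocode_eq] at h2
  rw [Matrix.mul_apply]
  simp only [spMat]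
  rw [sum_mul_spVec]
  exact Int.dvd_of_emod_eq_zero h2

/-- **Rank upper bounds** from certified kernel vectors modulo `d` (`d = 0` in `F`). [folklore] -/
theorem rank_orbitForm_add_le_of_okerCheck {F : Type*} [Field F] {d : ℤ} (hd : (d : F) = 0)
    {N : Fin 3 → Fin 3 → Fin 3 → ℤ} {k : ℕ} {Ls : List (List (ℕ × ℤ))}
    (h : okerCheck d N k Ls = true) (fc : ℕ → Fin k) {rows : List (List (ℕ × ℤ))} {piv : List ℕ}
    (hW : intTriCheckUnit k (fun r c => spMat Ls k (dec r) (fc c)) rows piv = true) :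
    (orbitForm (fun a b c => (N a b c : F))).rank + k ≤ 27 := by
  have hW' := le_rank_of_intTriCheckUnit (F := F) (spMat Ls k) dec fc hW
  have hprod : orbitForm (fun a b c => (N a b c : F)) * (spMat Ls k).map (Int.cast : ℤ → F) = 0 := by
    ext p i
    obtain ⟨y, hy⟩ := dvd_of_okerCheck h p i
    rw [Matrix.mul_apply] at hy
    simp only [Matrix.mul_apply, Matrix.map_apply, Matrix.zero_apply, orbitForm_intCast,
      ← Int.cast_mul, ← Int.cast_sum, hy]
    rw [Int.cast_mul, hd, zero_mul]
  have := Matrix.rank_add_rank_le_card_of_mul_eq_zero hprod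
  simp only [Fintype.card_prod, Fintype.card_fin] at this
  omega

end Cert

/-! ## The data: `rank O_{N₅} ≥ 21` everywhere, `rank O_{cw₂} ≤ 20` in characteristic `2` -/

section Data

/-- `rank O_{N₅} ≥ 21` certificate (unit pivots). [cite: Nurmiev2000, Table 2] -/
theorem nurmiev_five_ocert : intTriCheckUnit 21 (ocode (nurmievInt 5))
    [[(7, 1), (13, -1)], [(3, 1), (4, -1)], [(0, -1), (1, 1)], [(11, 1)],
      [(6, -1), (7, 1), (12, 1), (13, -1), (18, 1)], [(10, 1)], [(24, 1)], [(21, 1)],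
      [(2, -1), (7, 1), (13, -1), (19, 1)], [(2, -1), (7, 1), (13, -1)], [(9, 1)], [(0, 1)], [(5, 1)],
      [(4, 1)], [(8, 1), (14, -1), (20, -1), (24, 1)], [(11, -1), (15, 1)],
      [(6, -1), (7, 1), (13, -1), (18, 1)], [(18, 1)], [(13, 1)], [(14, 1)], [(20, -1), (24, 1)]]
    [0, 1, 2, 3, 4, 5, 6, 7, 8, 9, 10, 11, 12, 14, 15, 16, 18, 19, 21, 24, 25] = true := by
  decide +kernel

/-- The `7` kernel vectors of `O_{cw₂}` modulo `2` (sparse, on column codes `9f+3p+q`). [folklore] -/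
def cwTwoOKerTwo : List (List (ℕ × ℤ)) :=
  [[(0, 1), (4, 1), (8, 1), (9, 1), (13, 1), (17, 1)], [(4, 1), (8, 1), (9, 1), (18, 1)],
    [(1, 1), (10, 1), (19, 1)], [(2, 1), (11, 1), (20, 1)], [(4, 1), (13, 1), (22, 1)],
    [(5, 1), (7, 1), (14, 1), (16, 1), (23, 1), (25, 1)], [(0, 1), (4, 1), (9, 1), (13, 1), (26, 1)]]

/-- The kernel vectors are killed modulo `2`. [folklore] -/
theorem cwTwo_okerCheck_two : okerCheck 2 cwTwoInt 7 cwTwoOKerTwo = true := by decide +kernel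

/-- The kernel vectors are independent in every characteristic (unit pivots at the free columns).
[folklore] -/
theorem cwTwo_okerW_two :
    intTriCheckUnit 7 (fun r c => spMat cwTwoOKerTwo 7 (dec r) (finCode 7 c))
      [[(17, 1)], [(18, 1)], [(19, 1)], [(20, 1)], [(22, 1)], [(25, 1)], [(26, 1)]]
      [0, 1, 2, 3, 4, 5, 6] = true := by
  decide +kernel

end Data

/-! ## Bounds and the non-degeneration -/

section Bounds

/-- **`rank O_{N₅} ≥ 21`** over every field. [cite: Nurmiev2000, Table 2] -/
theorem le_orbitRank_nurmiev_five (F : Type*) [Field F] : 21 ≤ (orbitForm (nurmiev F 5)).rank :=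
  le_rank_orbitForm_of_cert (F := F) (nurmievInt 5) nurmiev_five_ocert

/-- **`rank O_{cw₂} ≤ 20` in characteristic `2`** (it is `23` in characteristic `0`).
[cite: ConnerGesmundoLandsbergVentura2022, §3.2] -/
theorem orbitRank_cwTwo_le_of_two (F : Type*) [Field F] (h2 : (2 : F) = 0) :
    (orbitForm (fun a b c => (cwTwoInt a b c : F))).rank ≤ 20 := by
  have h := rank_orbitForm_add_le_of_okerCheck (F := F) (d := 2) (by simpa using h2)
    cwTwo_okerCheck_two (finCode 7) cwTwo_okerW_two
  omega

end Bounds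

section NonDegeneration

variable (K : Type u) [Field K]

/-- In characteristic `2`, `cw₂` degenerates only to tensors with `rank O ≤ 20`.
[cite: Alman2021, §2.4] -/
theorem orbitRank_le_of_cwTwo_degen_of_two (h2 : (2 : K) = 0) {N : Fin 3 → Fin 3 → Fin 3 → K}
    (h : PolyDegeneratesTo (cwTensor K 2) N) : (orbitForm N).rank ≤ 20 := by
  rw [cwTensor_two_eq_cast] at h
  exact rank_orbitForm_le_of_polyDegeneratesTo cwTwoInt h (by
    intro L _ φ
    refine orbitRank_cwTwo_le_of_two L ?_
    rw [show (2 : L) = φ 2 from (map_ofNat φ 2).symm, h2, map_zero])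

/-- **`cw₂ ⋭ N₅` over every field of characteristic `2`** (row `5` of the door tensor's census;
over `ℂ` the degeneration exists). [cite: Nurmiev2000, Table 2] -/
theorem not_cwTensor_two_polyDegeneratesTo_nurmiev_five_of_two (h2 : (2 : K) = 0) :
    ¬ PolyDegeneratesTo (cwTensor K 2) (nurmiev K 5) := fun h =>
  rank_absurd (le_orbitRank_nurmiev_five K) (orbitRank_le_of_cwTwo_degen_of_two K h2 h) (by omega)

end NonDegeneration

end OrbitRank

end Summit.MatrixMultiplication.MatrixMultiplication.Theorems
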